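import Summits.QuantumAdvantage.QuantumAdvantage.Theorems.CoSupportLawA

set_option linter.dupNamespace false

/-!
# LAW I (co-support law), part B — the ring walk, the quadratic grade, the dual certificate, the explicit polylog threshold

* `loss_of_coSupport`: registers = tables of `k` forms of all bits × ANY core ignoring `≥ m₁` free bits per register ⇒ loss once
  `(n+1)·2p^k·|W|·(2p−1)^{m₁} < (2p)^{m₁}` (every charge, every `n`, no degree hypothesis, no common structure across registers);
* `loss_of_linearSlack`: registers = functions of ONE `𝔽_p`-phase `N_g(u) + linear(u)` of ANY degree whose nonlinear part ignores
  `≥ m₁` bits ⇒ loss once `(n+1)·2p²·(2p−1)^{m₁} < (2p)^{m₁}` (LAW I read at the level of X's own objects);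
* `loss_of_quadCoSupport`: `QuadForm` registers (tables of `k` forms and one quadratic form) each leaving `≥ m₁` bits outside the
  off-diagonal support of its quadratic part ⇒ loss once `(n+1)·2p^{k+2}·(2p−1)^{m₁} < (2p)^{m₁}`; `loss_of_quadCoSupport_explicit`:
  `m₁ ≥ 2p·(log₂((n+1)·2p^{k+2}) + 1)` suffices (polylog);
* `loss_of_certificate`: an odd set of inputs meeting every live-firing set evenly refutes perfection (the dual normal form).
-/

open Finset
open Summit.QuantumAdvantage.AdviceFreeQNC0
open Summit.QuantumAdvantage.AdviceFreeQNC0.Coset21.CharTwoKill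

namespace Summit.QuantumAdvantage.QuantumAdvantage.Theorems.CoSupportDial

/-! ### §2 LAW I on the ring: registers = tables of `k` forms of all bits and of ANY core of the remaining structure -/

section Walk

variable {p : ℕ} [Fact p.Prime]

/-- splitting the count: `A·(q−1)^{m₁} < q^{m₁}` and `m₁ ≤ n` give the padded count used by the engine -/
theorem count_pad {A q m₁ n : ℕ} (hq : 0 < q) (hm : m₁ ≤ n) (h : A * (q - 1) ^ m₁ < q ^ m₁) :
    A * ((q - 1) ^ m₁ * q ^ (n - m₁)) < q ^ n := by
  calc A * ((q - 1) ^ m₁ * q ^ (n - m₁)) = (A * (q - 1) ^ m₁) * q ^ (n - m₁) := by ring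
    _ < q ^ m₁ * q ^ (n - m₁) := mul_lt_mul_of_pos_right h (pow_pos hq _)
    _ = q ^ n := by rw [← pow_add, Nat.add_sub_cancel' hm]

/-- **LAW I (co-support law, general cores).**  Let every register of `y` be a table of `k` linear forms `mod p` of the input and of a
CORE `N g u ∈ W` which does not depend on the bits in `free g` (`|free g| ≥ m₁` for every cut `g`).  If
`(n+1)·2p^k·|W|·(2p−1)^{m₁} < (2p)^{m₁}` then `y` loses at some input — for every charge `c`.  Nothing is assumed about the cores beyond
finiteness of `W`: they may be dense generic quadratics, higher-degree phases, different for every register, with no common structure. -/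
theorem loss_of_coSupport (hp5 : 5 ≤ p) {n k m₁ : ℕ} {W : Type*} [Fintype W] [DecidableEq W] (hm : m₁ ≤ n)
    (hcount : (n + 1) * (p ^ k * Fintype.card W * 2) * (2 * p - 1) ^ m₁ < (2 * p) ^ m₁) (c : ℕ)
    (y : Fin (n + 1) → (Fin n → Bool) → Bool)
    (lam : Fin (n + 1) → Fin k → Fin n → ZMod p) (N : Fin (n + 1) → (Fin n → Bool) → W)
    (F : Fin (n + 1) → (Fin k → ZMod p) → W → Bool)
    (hy : ∀ g u, y g u = F g (fun j => ∑ i, if u i = true then lam g j i else 0) (N g u))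
    (free : Fin (n + 1) → Finset (Fin n)) (hN : ∀ g, ∀ i ∈ free g, ∀ u b, N g (Function.update u i b) = N g u)
    (hfree : ∀ g, m₁ ≤ (free g).card) :
    ∃ u, ringWinU c y u = false := by
  classical
  obtain ⟨hK, ω, ζ, hω, hζ⟩ := Coset21.exists_charTwo_roots p hp5
  haveI := hK
  have hp0 : 0 < 2 * p := by omega
  have hcount' : Fintype.card (Fin (n + 1)) * (p ^ k * Fintype.card W * 2) * ((2 * p - 1) ^ m₁ * (2 * p) ^ (n - m₁))
      < (2 * p) ^ n := by
    rw [Fintype.card_fin]; exact count_pad hp0 hm hcount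
  obtain ⟨u, hu⟩ := abstract_even_existsC ω ζ hω lam N F (fun g : Fin (n + 1) => c + g.val)
    (fun (g : Fin (n + 1)) (i : Fin n) => ww g.val i) hp5 hζ (fun g i => ww_mem g.val i) free hN m₁ hfree hcount'
  refine ⟨u, ?_⟩
  rw [Bool.eq_false_iff]
  intro hwin
  simp only [ringWinU, decide_eq_true_eq] at hwin
  have hfilter : (univ.filter fun g : Fin (n + 1) => y g u = true ∧ (c + g.val + walkExp u g.val) % 3 ≠ 0)
      = (univ.filter fun g : Fin (n + 1) =>
          F g (kForm lam g u) (N g u) = true ∧ ((c + g.val) + wForm (fun g' i => ww g'.val i) g u) % 3 ≠ 0) := by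
    refine filter_congr fun g _ => ?_
    rw [hy g u, walkExp_eq_sum]
    unfold kForm wForm
    simp only [add_assoc]
  rw [hfilter] at hwin
  omega

/-- **LAW I for polynomial phases of ANY degree (`loss_of_linearSlack`).**  Let register `g` be any function of ONE quantity
`P_g(u) = N_g(u) + Σ_i [u_i]·c_{g,i} ∈ 𝔽_p`, where the «nonlinear part» `N_g` ignores the bits of `free g` (the bits that occur in `P_g`
only LINEARLY) and `|free g| ≥ m₁` for every cut.  If `(n+1)·2p²·(2p−1)^{m₁} < (2p)^{m₁}` (`m₁ = O(p·log(np))`) the strategy loses.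
Read contrapositively at the level of X itself: in a PERFECT strategy of `𝔽_p`-polynomial registers, for EVERY register all but `< m₁ = O(p log(np))` of the `n` bits occur in a nonlinear monomial of that register's phase polynomial;
the degree of the polynomial plays no role. -/
theorem loss_of_linearSlack (hp5 : 5 ≤ p) {n m₁ : ℕ} (hm : m₁ ≤ n)
    (hcount : (n + 1) * (p * p * 2) * (2 * p - 1) ^ m₁ < (2 * p) ^ m₁) (c : ℕ)
    (y : Fin (n + 1) → (Fin n → Bool) → Bool) (coef : Fin (n + 1) → Fin n → ZMod p)
    (N : Fin (n + 1) → (Fin n → Bool) → ZMod p) (F : Fin (n + 1) → ZMod p → Bool)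
    (hy : ∀ g u, y g u = F g (N g u + ∑ i, if u i = true then coef g i else 0))
    (free : Fin (n + 1) → Finset (Fin n)) (hN : ∀ g, ∀ i ∈ free g, ∀ u b, N g (Function.update u i b) = N g u)
    (hfree : ∀ g, m₁ ≤ (free g).card) :
    ∃ u, ringWinU c y u = false := by
  have hcount' : (n + 1) * (p ^ 1 * Fintype.card (ZMod p) * 2) * (2 * p - 1) ^ m₁ < (2 * p) ^ m₁ := by
    rw [ZMod.card, pow_one]; exact hcount
  refine loss_of_coSupport hp5 hm hcount' c y (fun g (_ : Fin 1) i => coef g i) N (fun g x w => F g (w + x 0))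
    (fun g u => ?_) free hN hfree
  rw [hy g u]

end Walk

/-! ### §3 The quadratic grade: free bits = bits outside the off-diagonal support of the register's quadratic part -/

section Quad

variable {p : ℕ} [Fact p.Prime] {n : ℕ}

/-- the off-diagonal part `Σ_{i ≠ i'} [u_i][u_{i'}] M_{i i'}` of a quadratic form on the cube -/
def offDiagVal (M : Fin n → Fin n → ZMod p) (u : Fin n → Bool) : ZMod p :=
  ∑ i, ∑ i', if i ≠ i' ∧ u i = true ∧ u i' = true then M i i' else 0

/-- the bits the quadratic part of `M` does not touch: row and column `i` of `M` vanish off the diagonal -/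
def freeOf (M : Fin n → Fin n → ZMod p) : Finset (Fin n) :=
  univ.filter fun i => ∀ j, j ≠ i → M i j = 0 ∧ M j i = 0

/-- on the cube a quadratic form is its off-diagonal part plus the LINEAR form `Σ_i [u_i](M_{ii} + b_i)` (`u_i² = u_i`) -/
theorem quadVal_split (M : Fin n → Fin n → ZMod p) (b : Fin n → ZMod p) (u : Fin n → Bool) :
    InnerDegreeDial.quadVal M b u = offDiagVal M u + ∑ i, if u i = true then (M i i + b i) else 0 := by
  classical
  unfold InnerDegreeDial.quadVal offDiagVal
  have h : ∀ i, (∑ i', if u i = true then (if u i' = true then M i i' else 0) else 0)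
      = (if u i = true then M i i else 0) + ∑ i', if i ≠ i' ∧ u i = true ∧ u i' = true then M i i' else 0 := by
    intro i
    rw [← Finset.add_sum_erase univ _ (mem_univ i), ← Finset.add_sum_erase univ
      (fun i' => if i ≠ i' ∧ u i = true ∧ u i' = true then M i i' else 0) (mem_univ i)]
    have h0 : (if i ≠ i ∧ u i = true ∧ u i = true then M i i else 0) = 0 := by simp
    rw [h0, zero_add]
    congr 1
    · by_cases hu : u i = true <;> simp [hu]
    · refine sum_congr rfl fun i' hi' => ?_
      have hne : i ≠ i' := (ne_of_mem_erase hi').symm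
      by_cases hu : u i = true <;> by_cases hu' : u i' = true <;> simp [hu, hu', hne]
  simp_rw [h]
  rw [sum_add_distrib, add_assoc, add_comm (∑ i, ∑ i', _) _, ← add_assoc, ← sum_add_distrib, add_comm]
  congr 1
  refine sum_congr rfl fun i _ => ?_
  by_cases hu : u i = true <;> simp [hu]

/-- flipping a free bit does not change the off-diagonal part -/
theorem offDiagVal_update (M : Fin n → Fin n → ZMod p) {i : Fin n} (hi : i ∈ freeOf M) (u : Fin n → Bool) (c : Bool) :
    offDiagVal M (Function.update u i c) = offDiagVal M u := by
  classical
  rw [freeOf, mem_filter] at hi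
  obtain ⟨-, hi⟩ := hi
  unfold offDiagVal
  refine sum_congr rfl fun i₁ _ => sum_congr rfl fun i₂ _ => ?_
  by_cases h₁ : i₁ = i
  · subst h₁
    by_cases h12 : i₁ = i₂
    · simp [h12]
    · have : M i₁ i₂ = 0 := (hi i₂ (Ne.symm h12)).1
      simp [this]
  · by_cases h₂ : i₂ = i
    · subst h₂
      have : M i₁ i₂ = 0 := (hi i₁ h₁).2
      simp [this]
    · rw [Function.update_of_ne h₁, Function.update_of_ne h₂]

/-- **LAW I, quadratic grade (`loss_of_quadCoSupport`).**  A `QuadForm` strategy (registers = tables of `k` linear forms and one quadratic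
form `mod p`) in which EVERY register's quadratic part leaves `≥ m₁` bits free (off its off-diagonal support) loses at some input once
`(n+1)·2p^{k+2}·(2p−1)^{m₁} < (2p)^{m₁}` — for every charge; the quadratic parts are otherwise arbitrary (dense, generic, high rank,
pairwise unrelated).  [core = off-diagonal part, `W = 𝔽_p`; the diagonal and linear parts join the forms as a `(k+1)`-st linear form] -/
theorem loss_of_quadCoSupport (hp5 : 5 ≤ p) {k m₁ : ℕ} (hm : m₁ ≤ n)
    (hcount : (n + 1) * (p ^ (k + 1) * p * 2) * (2 * p - 1) ^ m₁ < (2 * p) ^ m₁) (c : ℕ)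
    (y : Fin (n + 1) → (Fin n → Bool) → Bool)
    (lam : Fin (n + 1) → Fin k → Fin n → ZMod p) (M : Fin (n + 1) → Fin n → Fin n → ZMod p)
    (b : Fin (n + 1) → Fin n → ZMod p) (F : Fin (n + 1) → (Fin k → ZMod p) → ZMod p → Bool)
    (hy : ∀ g u, y g u = F g (fun j => ∑ i, if u i = true then lam g j i else 0) (InnerDegreeDial.quadVal (M g) (b g) u))
    (hfree : ∀ g, m₁ ≤ (freeOf (M g)).card) :
    ∃ u, ringWinU c y u = false := by
  classical
  -- the `k+1` forms: the old ones and the diagonal-plus-linear form of the register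
  let lam' : Fin (n + 1) → Fin (k + 1) → Fin n → ZMod p := fun g => Fin.snoc (lam g) (fun i => M g i i + b g i)
  let F' : Fin (n + 1) → (Fin (k + 1) → ZMod p) → ZMod p → Bool :=
    fun g x q => F g (fun j => x (Fin.castSucc j)) (q + x (Fin.last k))
  have hcount' : (n + 1) * (p ^ (k + 1) * Fintype.card (ZMod p) * 2) * (2 * p - 1) ^ m₁ < (2 * p) ^ m₁ := by
    rw [ZMod.card]; exact hcount
  refine loss_of_coSupport hp5 hm hcount' c y lam' (fun g u => offDiagVal (M g) u) F' (fun g u => ?_)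
    (fun g => freeOf (M g)) (fun g i hi u c' => offDiagVal_update (M g) hi u c') hfree
  rw [hy g u, quadVal_split]
  simp only [F', lam', Fin.snoc_castSucc, Fin.snoc_last]

end Quad

/-! ### §4 The dual normal form of a refutation: odd sets meeting every live-firing set evenly -/

section Certificate

variable {n : ℕ}

/-- **certificate ⟹ loss.**  If an ODD set `A` of inputs meets every register's live-firing set in an EVEN number of inputs, the strategy
loses at some input of `A` (double counting mod 2).  Every char-two law of this tree is, unfolded, such a certificate (weighted by `Φ_γ`);
conversely (linear algebra over `𝔽₂`, NODE-g28.md §6) a strategy none of whose silencings is perfect has one. -/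
theorem loss_of_certificate (c : ℕ) (y : Fin (n + 1) → (Fin n → Bool) → Bool) (A : Finset (Fin n → Bool)) (hA : A.card % 2 = 1)
    (heven : ∀ g : Fin (n + 1), (A.filter fun u => y g u = true ∧ (c + g.val + walkExp u g.val) % 3 ≠ 0).card % 2 = 0) :
    ∃ u ∈ A, ringWinU c y u = false := by
  classical
  by_contra hno
  push Not at hno
  have hdc : ∑ u ∈ A, (univ.filter fun g : Fin (n + 1) => y g u = true ∧ (c + g.val + walkExp u g.val) % 3 ≠ 0).card
      = ∑ g : Fin (n + 1), (A.filter fun u => y g u = true ∧ (c + g.val + walkExp u g.val) % 3 ≠ 0).card := by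
    simp_rw [card_filter]
    exact Finset.sum_comm
  have hL : (∑ u ∈ A, (univ.filter fun g : Fin (n + 1) => y g u = true ∧ (c + g.val + walkExp u g.val) % 3 ≠ 0).card) % 2 = 1 := by
    rw [Finset.sum_nat_mod, Finset.sum_congr rfl (g := fun _ => 1)]
    · rw [sum_const, smul_eq_mul, mul_one]; exact hA
    · intro u hu
      have h := hno u hu
      simp only [ne_eq, Bool.not_eq_false, ringWinU, decide_eq_true_eq] at h
      exact h
  have hR : (∑ g : Fin (n + 1), (A.filter fun u => y g u = true ∧ (c + g.val + walkExp u g.val) % 3 ≠ 0).card) % 2 = 0 := by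
    rw [Finset.sum_nat_mod, Finset.sum_eq_zero (fun g _ => heven g), Nat.zero_mod]
  rw [hdc] at hL
  omega

end Certificate

/-! ### §5 The threshold is polylog: `m₁ = 2p·(log₂((n+1)·2p^{k+2}) + 1)` free bits suffice -/

section ExplicitCount

variable {p : ℕ} [Fact p.Prime] {n : ℕ}

/-- Bernoulli, two binomial terms: `b^{N+1} + (N+1)·b^N ≤ (b+1)^{N+1}` -/
theorem pow_add_mul_pow_le (b : ℕ) : ∀ N : ℕ, b ^ (N + 1) + (N + 1) * b ^ N ≤ (b + 1) ^ (N + 1)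
  | 0 => by simp
  | N + 1 => by
    have ih := pow_add_mul_pow_le b N
    have hexp : (b + 1) * (b ^ (N + 1) + (N + 1) * b ^ N) = b ^ (N + 2) + (N + 2) * b ^ (N + 1) + (N + 1) * b ^ N := by ring
    calc b ^ (N + 1 + 1) + (N + 1 + 1) * b ^ (N + 1)
        ≤ b ^ (N + 2) + (N + 2) * b ^ (N + 1) + (N + 1) * b ^ N := by rw [add_assoc]; exact Nat.le_add_right _ _
      _ = (b + 1) * (b ^ (N + 1) + (N + 1) * b ^ N) := hexp.symm
      _ ≤ (b + 1) * (b + 1) ^ (N + 1) := Nat.mul_le_mul_left _ ih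
      _ = (b + 1) ^ (N + 1 + 1) := by ring

/-- every block of `q` further free bits at least doubles the ratio: `2·(q−1)^q ≤ q^q` (`q ≥ 1`) -/
theorem two_mul_pow_le (q : ℕ) (hq : 1 ≤ q) : 2 * (q - 1) ^ q ≤ q ^ q := by
  obtain ⟨b, rfl⟩ : ∃ b, q = b + 1 := ⟨q - 1, by omega⟩
  simp only [Nat.add_sub_cancel]
  have h := pow_add_mul_pow_le b b
  have h2 : b ^ (b + 1) ≤ (b + 1) * b ^ b := by rw [pow_succ]; nlinarith [Nat.zero_le (b ^ b)]
  omega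

/-- `j` blocks: `2^j·(q−1)^{qj} ≤ q^{qj}` -/
theorem two_pow_mul_pow_le (q j : ℕ) (hq : 1 ≤ q) : 2 ^ j * (q - 1) ^ (q * j) ≤ q ^ (q * j) := by
  rw [pow_mul, pow_mul, ← mul_pow]
  exact Nat.pow_le_pow_left (two_mul_pow_le q hq) j

/-- the count is monotone in the number of free bits -/
theorem count_mono {A q m m' : ℕ} (hq : 0 < q) (hmm : m ≤ m') (h : A * (q - 1) ^ m < q ^ m) :
    A * (q - 1) ^ m' < q ^ m' := by
  obtain ⟨d, rfl⟩ := Nat.exists_eq_add_of_le hmm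
  rw [pow_add, pow_add, ← mul_assoc]
  calc A * (q - 1) ^ m * (q - 1) ^ d ≤ A * (q - 1) ^ m * q ^ d :=
        Nat.mul_le_mul_left _ (Nat.pow_le_pow_left (Nat.sub_le q 1) d)
    _ < q ^ m * q ^ d := mul_lt_mul_of_pos_right h (pow_pos hq d)

/-- **explicit threshold:** if `A < 2^j` then `A·(q−1)^m < q^m` for every `m ≥ q·j` (`q ≥ 2`) -/
theorem count_of_blocks {A q j m : ℕ} (hq : 2 ≤ q) (hA : A < 2 ^ j) (hm : q * j ≤ m) : A * (q - 1) ^ m < q ^ m := by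
  refine count_mono (by omega) hm ?_
  have hpos : 0 < (q - 1) ^ (q * j) := pow_pos (by omega) _
  calc A * (q - 1) ^ (q * j) < 2 ^ j * (q - 1) ^ (q * j) := mul_lt_mul_of_pos_right hA hpos
    _ ≤ q ^ (q * j) := two_pow_mul_pow_le q j (by omega)

/-- **LAW I, quadratic grade, explicit threshold:** `m₁ ≥ 2p·(log₂((n+1)·2p^{k+2}) + 1)` free bits per register (`m₁ ≤ n`) force a
loss — `m₁ = O(p·(log n + k log p))`, polylogarithmic for polylog width `k`. -/
theorem loss_of_quadCoSupport_explicit (hp5 : 5 ≤ p) {k m₁ : ℕ}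
    (hm₁ : 2 * p * (Nat.log 2 ((n + 1) * (p ^ (k + 1) * p * 2)) + 1) ≤ m₁) (hm : m₁ ≤ n) (c : ℕ)
    (y : Fin (n + 1) → (Fin n → Bool) → Bool)
    (lam : Fin (n + 1) → Fin k → Fin n → ZMod p) (M : Fin (n + 1) → Fin n → Fin n → ZMod p)
    (b : Fin (n + 1) → Fin n → ZMod p) (F : Fin (n + 1) → (Fin k → ZMod p) → ZMod p → Bool)
    (hy : ∀ g u, y g u = F g (fun j => ∑ i, if u i = true then lam g j i else 0) (InnerDegreeDial.quadVal (M g) (b g) u))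
    (hfree : ∀ g, m₁ ≤ (freeOf (M g)).card) :
    ∃ u, ringWinU c y u = false :=
  loss_of_quadCoSupport hp5 hm (count_of_blocks (q := 2 * p) (by omega) (Nat.lt_pow_succ_log_self Nat.one_lt_two _) hm₁)
    c y lam M b F hy hfree

end ExplicitCount

end Summit.QuantumAdvantage.QuantumAdvantage.Theorems.CoSupportDial
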